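import Mathlib
import Summits.NavierStokesRegularity.NavierStokesRegularity.Theses.RootDecompLitSlice
import Summits.NavierStokesRegularity.NavierStokesRegularity.Theorems.RootDecompLitSliceGeneralWindowTradeoffStubWindowHardy
import Summits.NavierStokesRegularity.NavierStokesRegularity.Theorems.RootDecompLitSliceGeneralWindowTradeoffStubEnergyDrop
import HarnessLib

/-!
# Route RootDecompLitSlice — the TWO-EXPONENT ENERGY–CLOCK SCAR LAW `α(a,b) = 2b/(1+b−a)` and the
  exact content of the cell Uᶜ `CritTameScarIsCritical` (stmt-NavierStokesRegularity-31733)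

Helper lemmas toward the Tao-vacuous cell Uᶜ «a critically tame blow-up has critical scars»
(`Theses.RootDecompLitSlice.CritTameScarIsCritical`, ⟨31733⟩; no registered stubs — these are
`--supports` helpers, not items).

The landed free-window trade-off stub (M) `GeneralWindowTradeoff.stub_windowHardyEnergy`
(`∫_{B_r(x₀)}|u(T)|² ≤ 2H + 4(r²/(ντ))·(‖u(T−τ)‖₂² − ‖u(T)‖₂²)` whenever `∫|u(t)−u(T)|² ≤ H` on
`[T−τ,T)`) exposes the ENERGY DROP over the window. Grading a solution near its terminal time `T` by
TWO exponents — the CLOCK `b` (`∫|u(t)−u(T)|² ≤ K(T−t)^b`) and the ENERGY LAW `a`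
(`‖u(t)‖₂² − ‖u(T)‖₂² ≤ C(T−t)^a`) — and optimising the window (`τ = r^{2/(1+b−a)}`) gives

* `EnergyClockScarLaw.energyClockScarRung` (`0 < b`, `b − 1 ≤ a < 1 + b`): scar order
  `α(a,b) = 2b/(1+b−a)`, i.e. `∫_{B_r(x₀)}|u(T)|² ≤ C' r^{2b/(1+b−a)}` for small `r`, at every `x₀`;
* `EnergyClockScarLaw.energyLaw_of_clock`: the landed stub (S) `stub_energyDrop_le_modulus` gives the
  energy exponent `a = b/2` FOR FREE from the clock (`‖u(t)‖² − ‖u(T)‖² ≤ 2‖u₀‖₂√K (T−t)^{b/2}`), and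
  `α(b/2, b) = 4b/(b+2)` is the landed clock→scar law `ClockScarLaw.clockScarRung`;
* `EnergyClockScarLaw.criticalScar_of_energyClock`: `a + b ≥ 1` ⟹ `α ≥ 1` ⟹ CRITICAL scars
  (`r⁻¹∫_{B_r(x₀)}|u(T)|² ≤ M`, Uᶜ's conclusion verbatim);
* `EnergyClockScarLaw.halfHolderClockCell`: the literal SUB-CELL of Uᶜ on the maximal-smooth frame
  «a critically tame (`b = 1/2`) first blow-up whose energy curve is ½-Hölder at `T` (`a = 1/2`) has
  critical scars» is a THEOREM;
* `EnergyClockScarLaw.critTameScarIsCritical_iff_roughCell`: hence, by kernel, Uᶜ ⟺ its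
  ENERGY-ROUGH sub-cell «a critically tame first blow-up whose energy curve is NOT ½-Hölder at `T`
  has critical scars» — the open content of Uᶜ is exactly the energy strip `a ∈ [1/4, 1/2)` over the
  critical clock `b = 1/2` (`a ≥ b/2 = 1/4` free, `a ≥ 1/2` closes).

HONEST FRAMING: theorem layers INSIDE the Tao-vacuous cell Uᶜ (no item, no node; banked context for
the cell's planner): Tao's cascade (`b ≈ 0.008`) and every abrupt blow-up stay in Uᵃ; no load of the
route moves (ROOT ⟺ U ∧ P1, critic rows 354/371/563). The ½-Hölder energy law is the piece
`EnergyHalfHolder` of the sibling thesis HalfHolderEnergy read INSIDE Uᶜ, not a new hypothesis on the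
summit. Rung 0: nothing here proves NS regularity. Decomp-ns route-writer g36. [folklore]
-/

set_option linter.dupNamespace false

namespace Summit.NavierStokesRegularity.NavierStokesRegularity.Theorems

open MeasureTheory Set
open scoped ENNReal

namespace EnergyClockScarLaw

/-- ★ **The two-exponent energy–clock scar law `α(a,b) = 2b/(1+b−a)`** on the classical Leray–Hopf
frame (classical on `[0,T)`, Leray–Hopf on `[0,T]`, rapidly decaying datum): clock
`∫|u(t)−u(T)|² ≤ K(T−t)^b` and energy law `‖u(t)‖₂² − ‖u(T)‖₂² ≤ C(T−t)^a` near `T`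
⟹ `∫_{B_r(x₀)}|u(T)|² ≤ C' r^{2b/(1+b−a)}` for small `r`, at every `x₀`
(`0 < b`, `b − 1 ≤ a < 1 + b`). Stub (M) with the window `τ = r^{2/(1+b−a)} ≤ r ≤ 1` and the
level `H = max K 0 · τ^b`. [folklore] -/
theorem energyClockScarRung {a b : ℝ} (hb : 0 < b) (hab : b - 1 ≤ a) (hab' : a < 1 + b) :
    ∀ (ν T : ℝ), 0 < ν → 0 < T →
    ∀ (u : ℝ → EuclideanSpace ℝ (Fin 3) → EuclideanSpace ℝ (Fin 3))
      (p : ℝ → EuclideanSpace ℝ (Fin 3) → ℝ),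
      Literature.Analysis.FluidPDE.IsClassicalNSSolutionOn (Set.Ico 0 T) ν 0 u p →
      Literature.Analysis.FluidPDE.IsLerayHopfOn T ν 0 (u 0) u →
      Literature.Analysis.FluidPDE.HasRapidSpatialDecay (u 0) →
      (∃ K T₁ : ℝ, T₁ < T ∧ ∀ t ∈ Set.Ioo T₁ T,
        ∫⁻ x, ‖u t x - u T x‖ₑ ^ 2 ≤ ENNReal.ofReal (K * (T - t) ^ b)) →
      (∃ C T₂ : ℝ, T₂ < T ∧ ∀ t ∈ Set.Ioo T₂ T,
        (∫ x, ‖u t x‖ ^ 2) - ∫ x, ‖u T x‖ ^ 2 ≤ C * (T - t) ^ a) →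
      ∀ x₀ : EuclideanSpace ℝ (Fin 3), ∃ C' r₁ : ℝ, 0 < r₁ ∧ ∀ r ∈ Set.Ioo 0 r₁,
        ∫ x in Metric.ball x₀ r, ‖u T x‖ ^ 2 ≤ C' * r ^ (2 * b / (1 + b - a)) := by
  intro ν T hν hT u p hcl hLH hdec hclock henergy x₀
  obtain ⟨K, T₁, hT₁, hK⟩ := hclock
  obtain ⟨C, T₂, hT₂, hC⟩ := henergy
  obtain ⟨K', hK'def⟩ : ∃ K' : ℝ, K' = max K 0 := ⟨_, rfl⟩
  have hK'nn : 0 ≤ K' := by rw [hK'def]; exact le_max_right _ _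
  have hKK' : K ≤ K' := by rw [hK'def]; exact le_max_left _ _
  obtain ⟨C', hC'def⟩ : ∃ C' : ℝ, C' = max C 0 := ⟨_, rfl⟩
  have hC'nn : 0 ≤ C' := by rw [hC'def]; exact le_max_right _ _
  have hCC' : C ≤ C' := by rw [hC'def]; exact le_max_left _ _
  have hgap : 0 < 1 + b - a := by linarith
  obtain ⟨e, hedef⟩ : ∃ e : ℝ, e = 2 / (1 + b - a) := ⟨_, rfl⟩
  have he1 : 1 ≤ e := by
    rw [hedef, le_div_iff₀ hgap]; linarith
  obtain ⟨δ, hδdef⟩ : ∃ δ : ℝ, δ = min 1 (min (T - max T₁ T₂) T) := ⟨_, rfl⟩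
  have hmaxT : max T₁ T₂ < T := max_lt hT₁ hT₂
  have hδpos : 0 < δ := by
    rw [hδdef]; exact lt_min one_pos (lt_min (sub_pos.mpr hmaxT) hT)
  refine ⟨2 * K' + 4 / ν * C', δ, hδpos, ?_⟩
  intro r hr
  have hr0 : 0 < r := hr.1
  have hrδ : r < δ := hr.2
  have hr1 : r ≤ 1 := hrδ.le.trans (by rw [hδdef]; exact min_le_left _ _)
  have hrTm : r < T - max T₁ T₂ :=
    lt_of_lt_of_le hrδ (by rw [hδdef]; exact (min_le_right _ _).trans (min_le_left _ _))
  have hrT : r < T :=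
    lt_of_lt_of_le hrδ (by rw [hδdef]; exact (min_le_right _ _).trans (min_le_right _ _))
  have hrT₁ : r < T - T₁ := by
    have := le_max_left T₁ T₂; linarith
  have hrT₂ : r < T - T₂ := by
    have := le_max_right T₁ T₂; linarith
  -- the window
  obtain ⟨τ, hτdef⟩ : ∃ τ : ℝ, τ = r ^ e := ⟨_, rfl⟩
  have hτpos : 0 < τ := by rw [hτdef]; exact Real.rpow_pos_of_pos hr0 e
  have hτler : τ ≤ r := by
    have h1 := Real.rpow_le_rpow_of_exponent_ge hr0 hr1 he1
    rw [Real.rpow_one] at h1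
    rw [hτdef]; exact h1
  have hτT : τ < T := lt_of_le_of_lt hτler hrT
  have hτT₁ : τ < T - T₁ := lt_of_le_of_lt hτler hrT₁
  have hτT₂ : τ < T - T₂ := lt_of_le_of_lt hτler hrT₂
  -- the modulus level
  obtain ⟨H, hHdef⟩ : ∃ H : ℝ, H = K' * τ ^ b := ⟨_, rfl⟩
  have hτb : 0 ≤ τ ^ b := Real.rpow_nonneg hτpos.le b
  have hH : 0 ≤ H := by rw [hHdef]; exact mul_nonneg hK'nn hτb
  have hmod : ∀ t ∈ Set.Ico (T - τ) T,
      ∫⁻ x, ‖u t x - u T x‖ₑ ^ 2 ≤ ENNReal.ofReal H := by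
    intro t ht
    have ht1 : T₁ < t := by linarith [ht.1]
    refine (hK t ⟨ht1, ht.2⟩).trans (ENNReal.ofReal_le_ofReal ?_)
    have h0 : 0 ≤ T - t := by linarith [ht.2]
    have h1 : T - t ≤ τ := by linarith [ht.1]
    have hpow : (T - t) ^ b ≤ τ ^ b := Real.rpow_le_rpow h0 h1 hb.le
    rw [hHdef]
    calc K * (T - t) ^ b ≤ K' * (T - t) ^ b :=
          mul_le_mul_of_nonneg_right hKK' (Real.rpow_nonneg h0 b)
      _ ≤ K' * τ ^ b := mul_le_mul_of_nonneg_left hpow hK'nn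
  have hmain :=
    GeneralWindowTradeoff.stub_windowHardyEnergy ν T hν hT u p hcl hLH hdec x₀ r τ H hr0 hτpos hτT
      hH hmod
  -- the energy drop over the window
  have hdrop : (∫ x, ‖u (T - τ) x‖ ^ 2) - ∫ x, ‖u T x‖ ^ 2 ≤ C' * τ ^ a := by
    have hwin : T - τ ∈ Set.Ioo T₂ T := ⟨by linarith, by linarith⟩
    have h1 := hC (T - τ) hwin
    rw [show T - (T - τ) = τ by ring] at h1
    exact h1.trans (mul_le_mul_of_nonneg_right hCC' (Real.rpow_nonneg hτpos.le a))
  have hcoef : 0 ≤ 4 * (r ^ 2 / (ν * τ)) := by positivity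
  have hstep : ∫ x in Metric.ball x₀ r, ‖u T x‖ ^ 2 ≤
      2 * (K' * τ ^ b) + 4 * (r ^ 2 / (ν * τ)) * (C' * τ ^ a) := by
    refine hmain.trans ?_
    rw [hHdef]
    exact add_le_add le_rfl (mul_le_mul_of_nonneg_left hdrop hcoef)
  -- exponent bookkeeping
  have hexp1 : τ ^ b = r ^ (2 * b / (1 + b - a)) := by
    rw [hτdef, ← Real.rpow_mul hr0.le]
    congr 1
    rw [hedef]; field_simp
  have hexp2 : r ^ 2 / (ν * τ) * τ ^ a = ν⁻¹ * r ^ (2 * b / (1 + b - a)) := by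
    have hτa : τ ^ a = r ^ (e * a) := by rw [hτdef, ← Real.rpow_mul hr0.le]
    rw [hτa, hτdef, ← Real.rpow_two]
    rw [show r ^ (2 : ℝ) / (ν * r ^ e) * r ^ (e * a) = ν⁻¹ * (r ^ (2 : ℝ) / r ^ e * r ^ (e * a))
      by field_simp]
    rw [← Real.rpow_sub hr0, ← Real.rpow_add hr0]
    congr 2
    rw [hedef]; field_simp; ring
  refine hstep.trans (le_of_eq ?_)
  rw [show 4 * (r ^ 2 / (ν * τ)) * (C' * τ ^ a) = 4 * C' * (r ^ 2 / (ν * τ) * τ ^ a) by ring,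
    hexp2, hexp1]
  ring

/-- The energy exponent `a = b/2` is FREE from the clock: by the landed stub (S)
`GeneralWindowTradeoff.stub_energyDrop_le_modulus`, a clock `∫|u(t)−u(T)|² ≤ K(T−t)^b` near `T`
forces the energy law `‖u(t)‖₂² − ‖u(T)‖₂² ≤ 2‖u₀‖₂·√(max K 0)·(T−t)^{b/2}` near `T`
(so `α(b/2,b) = 4b/(b+2)` recovers `ClockScarLaw.clockScarRung`). [folklore] -/
theorem energyLaw_of_clock {b : ℝ} :
    ∀ (ν T : ℝ), 0 < ν → 0 < T →
    ∀ (u : ℝ → EuclideanSpace ℝ (Fin 3) → EuclideanSpace ℝ (Fin 3))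
      (p : ℝ → EuclideanSpace ℝ (Fin 3) → ℝ),
      Literature.Analysis.FluidPDE.IsClassicalNSSolutionOn (Set.Ico 0 T) ν 0 u p →
      Literature.Analysis.FluidPDE.IsLerayHopfOn T ν 0 (u 0) u →
      Literature.Analysis.FluidPDE.HasRapidSpatialDecay (u 0) →
      (∃ K T₁ : ℝ, T₁ < T ∧ ∀ t ∈ Set.Ioo T₁ T,
        ∫⁻ x, ‖u t x - u T x‖ₑ ^ 2 ≤ ENNReal.ofReal (K * (T - t) ^ b)) →
      ∃ C T₂ : ℝ, T₂ < T ∧ ∀ t ∈ Set.Ioo T₂ T,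
        (∫ x, ‖u t x‖ ^ 2) - ∫ x, ‖u T x‖ ^ 2 ≤ C * (T - t) ^ (b / 2) := by
  intro ν T hν hT u p hcl hLH hdec hclock
  obtain ⟨K, T₁, hT₁, hK⟩ := hclock
  obtain ⟨K', hK'def⟩ : ∃ K' : ℝ, K' = max K 0 := ⟨_, rfl⟩
  have hK'nn : 0 ≤ K' := by rw [hK'def]; exact le_max_right _ _
  have hKK' : K ≤ K' := by rw [hK'def]; exact le_max_left _ _
  refine ⟨2 * Real.sqrt (∫ x, ‖u 0 x‖ ^ 2) * Real.sqrt K', max T₁ 0, max_lt hT₁ hT, ?_⟩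
  intro t ht
  have ht₁ : T₁ < t := lt_of_le_of_lt (le_max_left _ _) ht.1
  have ht0 : 0 < t := lt_of_le_of_lt (le_max_right _ _) ht.1
  have h0 : 0 ≤ T - t := by linarith [ht.2]
  have hpow : 0 ≤ (T - t) ^ b := Real.rpow_nonneg h0 b
  have hH : 0 ≤ K' * (T - t) ^ b := mul_nonneg hK'nn hpow
  have hmod : ∫⁻ x, ‖u t x - u T x‖ₑ ^ 2 ≤ ENNReal.ofReal (K' * (T - t) ^ b) :=
    (hK t ⟨ht₁, ht.2⟩).trans (ENNReal.ofReal_le_ofReal (mul_le_mul_of_nonneg_right hKK' hpow))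
  have h1 := GeneralWindowTradeoff.stub_energyDrop_le_modulus ν T hν hT u p hcl hLH hdec t
    ⟨ht0.le, ht.2.le⟩ (K' * (T - t) ^ b) hH hmod
  have hsqrt : Real.sqrt (K' * (T - t) ^ b) = Real.sqrt K' * (T - t) ^ (b / 2) := by
    rw [Real.sqrt_mul hK'nn, Real.sqrt_eq_rpow ((T - t) ^ b), ← Real.rpow_mul h0,
      show b * (1 / 2 : ℝ) = b / 2 by ring]
  rw [hsqrt] at h1
  linarith [h1]

/-- **Endpoint**: `a + b ≥ 1` ⟹ `α(a,b) ≥ 1` ⟹ CRITICAL scars — `r⁻¹∫_{B_r(x₀)}|u(T)|² ≤ M` for small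
`r` at every `x₀` (Uᶜ's conclusion verbatim), on the classical Leray–Hopf frame, from a clock `b` and
an energy law `a` with `a + b ≥ 1` (`0 < b`, `b − 1 ≤ a < 1 + b`). [folklore] -/
theorem criticalScar_of_energyClock {a b : ℝ} (hb : 0 < b) (hab : b - 1 ≤ a) (hab' : a < 1 + b)
    (hsum : 1 ≤ a + b) :
    ∀ (ν T : ℝ), 0 < ν → 0 < T →
    ∀ (u : ℝ → EuclideanSpace ℝ (Fin 3) → EuclideanSpace ℝ (Fin 3))
      (p : ℝ → EuclideanSpace ℝ (Fin 3) → ℝ),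
      Literature.Analysis.FluidPDE.IsClassicalNSSolutionOn (Set.Ico 0 T) ν 0 u p →
      Literature.Analysis.FluidPDE.IsLerayHopfOn T ν 0 (u 0) u →
      Literature.Analysis.FluidPDE.HasRapidSpatialDecay (u 0) →
      (∃ K T₁ : ℝ, T₁ < T ∧ ∀ t ∈ Set.Ioo T₁ T,
        ∫⁻ x, ‖u t x - u T x‖ₑ ^ 2 ≤ ENNReal.ofReal (K * (T - t) ^ b)) →
      (∃ C T₂ : ℝ, T₂ < T ∧ ∀ t ∈ Set.Ioo T₂ T,
        (∫ x, ‖u t x‖ ^ 2) - ∫ x, ‖u T x‖ ^ 2 ≤ C * (T - t) ^ a) →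
      ∀ x₀ : EuclideanSpace ℝ (Fin 3), ∃ M r₁ : ℝ, 0 < r₁ ∧ ∀ r ∈ Set.Ioo 0 r₁,
        r⁻¹ * ∫ x in Metric.ball x₀ r, ‖u T x‖ ^ 2 ≤ M := by
  intro ν T hν hT u p hcl hLH hdec hclock henergy x₀
  obtain ⟨C', r₁, hr₁, hC'⟩ :=
    energyClockScarRung hb hab hab' ν T hν hT u p hcl hLH hdec hclock henergy x₀
  have hgap : 0 < 1 + b - a := by linarith
  have hα : 1 ≤ 2 * b / (1 + b - a) := by
    rw [le_div_iff₀ hgap]; linarith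
  -- the constant produced by `energyClockScarRung` may be used with `max C' 0`
  refine ⟨max C' 0, min r₁ 1, lt_min hr₁ one_pos, fun r hr => ?_⟩
  have hr0 : 0 < r := hr.1
  have hrr₁ : r < r₁ := lt_of_lt_of_le hr.2 (min_le_left _ _)
  have hr1 : r ≤ 1 := (lt_of_lt_of_le hr.2 (min_le_right _ _)).le
  have h1 := hC' r ⟨hr0, hrr₁⟩
  have hpow : r ^ (2 * b / (1 + b - a)) ≤ r := by
    have h2 := Real.rpow_le_rpow_of_exponent_ge hr0 hr1 hα
    rwa [Real.rpow_one] at h2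
  have h3 : ∫ x in Metric.ball x₀ r, ‖u T x‖ ^ 2 ≤ max C' 0 * r :=
    h1.trans ((mul_le_mul_of_nonneg_right (le_max_left _ _) (Real.rpow_nonneg hr0.le _)).trans
      (mul_le_mul_of_nonneg_left hpow (le_max_right _ _)))
  rw [inv_mul_le_iff₀ hr0]
  linarith [h3]

/-- **The ½-HÖLDER SUB-CELL of Uᶜ is a theorem** (maximal-smooth frame, Uᶜ's hypotheses and conclusion
VERBATIM plus the energy law `a = 1/2`): «a critically tame first blow-up
(`∫|u(t)−u(T)|² ≤ K√(T−t)`) whose energy curve is ½-Hölder at `T`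
(`‖u(t)‖₂² − ‖u(T)‖₂² ≤ C√(T−t)`) has critical scars». `criticalScar_of_energyClock` at
`a = b = 1/2`; tameness and maximality beyond `classical on [0,T)` are not used. [folklore] -/
theorem halfHolderClockCell :
    ∀ (ν T : ℝ), 0 < ν → 0 < T →
    ∀ (u : ℝ → EuclideanSpace ℝ (Fin 3) → EuclideanSpace ℝ (Fin 3))
      (p : ℝ → EuclideanSpace ℝ (Fin 3) → ℝ),
      Literature.Analysis.FluidPDE.IsMaximalSmoothSolution ν 0 u p T →
      Literature.Analysis.FluidPDE.IsLerayHopfOn T ν 0 (u 0) u →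
      Literature.Analysis.FluidPDE.HasRapidSpatialDecay (u 0) →
      Filter.Tendsto (fun t => MeasureTheory.eLpNorm (u t - u T) 2 MeasureTheory.volume)
        (nhdsWithin T (Set.Iio T)) (nhds 0) →
      (∃ K T₁ : ℝ, T₁ < T ∧ ∀ t ∈ Set.Ioo T₁ T,
        ∫⁻ x, ‖u t x - u T x‖ₑ ^ 2 ≤ ENNReal.ofReal (K * Real.sqrt (T - t))) →
      (∃ C T₂ : ℝ, T₂ < T ∧ ∀ t ∈ Set.Ioo T₂ T,
        (∫ x, ‖u t x‖ ^ 2) - ∫ x, ‖u T x‖ ^ 2 ≤ C * Real.sqrt (T - t)) →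
      ∀ x₀ : EuclideanSpace ℝ (Fin 3), ∃ M r₁ : ℝ, 0 < r₁ ∧ ∀ r ∈ Set.Ioo 0 r₁,
        r⁻¹ * ∫ x in Metric.ball x₀ r, ‖u T x‖ ^ 2 ≤ M := by
  intro ν T hν hT u p hmax hLH hdec _ hclock henergy x₀
  obtain ⟨K, T₁, hT₁, hK⟩ := hclock
  obtain ⟨C, T₂, hT₂, hC⟩ := henergy
  have hclock' : ∃ K T₁ : ℝ, T₁ < T ∧ ∀ t ∈ Set.Ioo T₁ T,
      ∫⁻ x, ‖u t x - u T x‖ₑ ^ 2 ≤ ENNReal.ofReal (K * (T - t) ^ (1 / 2 : ℝ)) :=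
    ⟨K, T₁, hT₁, fun t ht => by rw [← Real.sqrt_eq_rpow]; exact hK t ht⟩
  have henergy' : ∃ C T₂ : ℝ, T₂ < T ∧ ∀ t ∈ Set.Ioo T₂ T,
      (∫ x, ‖u t x‖ ^ 2) - ∫ x, ‖u T x‖ ^ 2 ≤ C * (T - t) ^ (1 / 2 : ℝ) :=
    ⟨C, T₂, hT₂, fun t ht => by rw [← Real.sqrt_eq_rpow]; exact hC t ht⟩
  exact criticalScar_of_energyClock (a := 1 / 2) (b := 1 / 2) (by norm_num) (by norm_num)
    (by norm_num) (by norm_num) ν T hν hT u p hmax.1 hLH hdec hclock' henergy' x₀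

/-- ★ **Uᶜ ⟺ its ENERGY-ROUGH sub-cell** (exact, by cases on the ½-Hölder energy law): the cell
`CritTameScarIsCritical` ⟨31733⟩ holds iff «a critically tame first blow-up whose energy curve is NOT
½-Hölder at `T` has critical scars» — the ½-Hölder sub-cell being the theorem `halfHolderClockCell`.
The open content of Uᶜ is the energy strip `a ∈ [1/4, 1/2)` over the critical clock `b = 1/2`
(`a ≥ 1/4` free by `energyLaw_of_clock`). [folklore] -/
theorem critTameScarIsCritical_iff_roughCell :
    Summit.NavierStokesRegularity.NavierStokesRegularity.Theses.RootDecompLitSlice.CritTameScarIsCritical ↔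
    (∀ (ν T : ℝ), 0 < ν → 0 < T →
    ∀ (u : ℝ → EuclideanSpace ℝ (Fin 3) → EuclideanSpace ℝ (Fin 3))
      (p : ℝ → EuclideanSpace ℝ (Fin 3) → ℝ),
      Literature.Analysis.FluidPDE.IsMaximalSmoothSolution ν 0 u p T →
      Literature.Analysis.FluidPDE.IsLerayHopfOn T ν 0 (u 0) u →
      Literature.Analysis.FluidPDE.HasRapidSpatialDecay (u 0) →
      Filter.Tendsto (fun t => MeasureTheory.eLpNorm (u t - u T) 2 MeasureTheory.volume)
        (nhdsWithin T (Set.Iio T)) (nhds 0) →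
      (∃ K T₁ : ℝ, T₁ < T ∧ ∀ t ∈ Set.Ioo T₁ T,
        ∫⁻ x, ‖u t x - u T x‖ₑ ^ 2 ≤ ENNReal.ofReal (K * Real.sqrt (T - t))) →
      ¬ (∃ C T₂ : ℝ, T₂ < T ∧ ∀ t ∈ Set.Ioo T₂ T,
        (∫ x, ‖u t x‖ ^ 2) - ∫ x, ‖u T x‖ ^ 2 ≤ C * Real.sqrt (T - t)) →
      ∀ x₀ : EuclideanSpace ℝ (Fin 3), ∃ M r₁ : ℝ, 0 < r₁ ∧ ∀ r ∈ Set.Ioo 0 r₁,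
        r⁻¹ * ∫ x in Metric.ball x₀ r, ‖u T x‖ ^ 2 ≤ M) := by
  constructor
  · intro h ν T hν hT u p hmax hLH hdec htame hclock _ x₀
    exact h ν T hν hT u p hmax hLH hdec htame hclock x₀
  · intro h ν T hν hT u p hmax hLH hdec htame hclock x₀
    by_cases henergy : ∃ C T₂ : ℝ, T₂ < T ∧ ∀ t ∈ Set.Ioo T₂ T,
        (∫ x, ‖u t x‖ ^ 2) - ∫ x, ‖u T x‖ ^ 2 ≤ C * Real.sqrt (T - t)
    · exact halfHolderClockCell ν T hν hT u p hmax hLH hdec htame hclock henergy x₀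
    · exact h ν T hν hT u p hmax hLH hdec htame hclock henergy x₀

end EnergyClockScarLaw

end Summit.NavierStokesRegularity.NavierStokesRegularity.Theorems
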